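import Mathlib
import HarnessLib
import Summits.HubbardSuperconductivity.HubbardSuperconductivity.Theorems.KLProgrammeKLRegimeVolumeLimitSunsetRate
import Summits.HubbardSuperconductivity.HubbardSuperconductivity.Theorems.KLProgrammeKLRegimeVolumeLimitSunsetFrameSymbol
import Summits.HubbardSuperconductivity.HubbardSuperconductivity.Theorems.KLProgrammeKLRegimeVolumeLimitFrameModulus

/-!
# Route `KLProgramme` — VL child `KLRegimeVolumeLimitV12` (stmt-HubbardSuperconductivity-19858), order-`U²` rung of the CAUCHY stub
# `stub_vl_twoVolumeRate`: the sunset of the FRAME PROPAGATOR of an ADMISSIBLE frame obeys the two-volume rate with torus modulus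
# (cell gate-hubbard-kl, seat hubbard-kl-k3c4-p1 g4; instance of `…VolumeLimitSunsetRate.klSunset_twoVolumeRate_stubShape`)

For `β > 0`, chemical potential `μ` and an ADMISSIBLE frame `K` (`FrameOK R U N μ K`, clause (i): `GeomConstants (frameLevel μ K) 7 …`, i.e.
`‖∇e_K‖ ≤ 7` on `ℝ²`), the frame propagator symbol family `g a x = (e_K(x) - iω_a)⁻¹` (`e_K = bandCT μ K`, `ω_a = fermiMatsubara β a`) is
admissible WITH MODULUS for the model-free two-volume theorem of `…VolumeLimitSunsetRate`:

* `klfr_bandCT_eq_frameLevel` — `bandCT μ K x = frameLevel μ K (toLp x)` (dictionary between the two continuum bands of the tree);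
* `klfr_abs_bandCT_sub_le` — `|e_K(x) − e_K(y)| ≤ 7√2·‖x − y‖_∞` under `FrameOK` (mean value `kled_abs_frameLevel_sub_le` + `‖·‖₂ ≤ √2‖·‖_∞`);
* `klfr_frameSymbol_sub_le` — **`‖(e_K(x) − iω_a)⁻¹ − (e_K(y) − iω_a)⁻¹‖ ≤ ((7√2·β²/(2π²))/|a+½|)·‖x − y‖_∞`** (`|ω_a| = (2π/β)|a+½|`,
  `klvf_norm_inv_sub_inv_le`, `|a+½| ≥ ½`);
* `klfr_abs_bandCT_zero_sub_le`, `klfr_bareSymbol_sub_le`, **`klSunset_bare_twoVolumeRate`** — the same at the BARE frame (`ξ = bandCT μ 0`,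
  Lipschitz `4`, `K = 2β²/π²`, no frame hypothesis: the symbol of the k3c5 lane's `sunsetSum_div_eq_klSunset`);
* **`klSunset_frame_twoVolumeRate`** — the sunset of the frame propagator satisfies the inequality of the registered stub
  `stub_vl_twoVolumeRate` (skeleton «cauchy», stmt-19858) with `klSunset` in place of the carrier: `∃ L₀ Mth D ρ, ρ → 0 ∧ ∀ L ≥ L₀ ∀ M ≥ Mth L
  ∀ L′ ≥ L ∀ M′ ≥ Mth L′ ∀ σ ω ω′ (same Matsubara integer) k k′, ‖Σ_{L,M} − Σ_{L′,M′}‖ ≤ ρ L + D·Σ_i |p_k i − p′_{k′} i|_𝕋`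
  (`C = β/2π`, `K = 7√2·β²/(2π²)`; `L₀ = 0`, `Mth = id`).

This is the order-`U²` (two-loop) WITNESS that the quantifier shape of the Cauchy stub is met by the leading momentum-dependent term of the
two-leg kernel at positive temperature, for EVERY admissible frame (the order-`U⁰` witness is `…ZeroCouplingRate`, the limit form of the
order-`U²` rung is `…VolumeLimitSunsetFrame`).  Nothing is asserted about the Hubbard model: the identification with the `U²`-coefficient of
`klSelfEnergy … (nScales β + 1)` is the true-carrier computation of the k3c5 lane.
-/

noncomputable section

namespace Summit.HubbardSuperconductivity.HubbardSuperconductivity.Theorems.KLRegimeSplit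

set_option linter.dupNamespace false -- summit = problem name (single-conjunct summit), D-0017

open Filter Topology Real Literature.MathematicalPhysics.QuantumLattice Literature.Probability.LatticeModels
open Literature.MathematicalPhysics.QuantumLattice.FermiRG
open Summit.HubbardSuperconductivity.HubbardSuperconductivity.Theorems.DispersionFlow
open Summit.HubbardSuperconductivity.HubbardSuperconductivity.Theorems.KLProgrammeLegKernels
open Summit.HubbardSuperconductivity.HubbardSuperconductivity.Theorems.TwoPointAssembly

/-! ## §1 The continuum frame band: dictionary and Lipschitz bound -/

/-- **Dictionary**: `bandCT μ K x = frameLevel μ K (toLp x)` (`-2(cos x₀ + cos x₁) − μ − K(x)` both ways). -/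
theorem klfr_bandCT_eq_frameLevel (μ : ℝ) (K : TrigPolyC4v) (x : Fin 2 → ℝ) :
    bandCT μ K x = frameLevel μ K (WithLp.toLp 2 x) := by
  simp [bandCT, frameLevel, squareDispersion, Fin.sum_univ_two]

/-- **`|e_K(x) − e_K(y)| ≤ 7√2·‖x − y‖_∞`** for an admissible frame (`FrameOK` (i)). -/
theorem klfr_abs_bandCT_sub_le {R : RenConsts} {U : ℝ} {N : ℕ} {μ : ℝ} {K : TrigPolyC4v} (hK : FrameOK R U N μ K)
    (x y : Fin 2 → ℝ) : |bandCT μ K x - bandCT μ K y| ≤ 7 * Real.sqrt 2 * ‖x - y‖ := by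
  rw [klfr_bandCT_eq_frameLevel, klfr_bandCT_eq_frameLevel]
  calc |frameLevel μ K (WithLp.toLp 2 x) - frameLevel μ K (WithLp.toLp 2 y)|
      ≤ 7 * ‖(WithLp.toLp 2 x : Momentum) - WithLp.toLp 2 y‖ := kled_abs_frameLevel_sub_le hK.1 _ _
    _ = 7 * ‖(WithLp.toLp 2 (x - y) : Momentum)‖ := by rw [WithLp.toLp_sub]
    _ ≤ 7 * (Real.sqrt 2 * ‖x - y‖) := by gcongr; exact klvf_norm_toLp_two_le _
    _ = 7 * Real.sqrt 2 * ‖x - y‖ := by ring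

/-! ## §2 The frame propagator symbol has the admissible Lipschitz modulus -/

/-- `1/ω_a² ≤ (β/2π)²·2/|a+½|` (`|ω_a| = (2π/β)|a+½|`, `|a+½| ≥ ½`). -/
theorem klfr_inv_sq_fermiMatsubara_le {β : ℝ} (hβ : 0 < β) (a : ℤ) :
    ((fermiMatsubara β a) ^ 2)⁻¹ ≤ (β / (2 * π)) ^ 2 * 2 / |(a : ℝ) + 1 / 2| := by
  have ha := klsf_abs_add_half_pos a
  have hhalf : (1 : ℝ) / 2 ≤ |(a : ℝ) + 1 / 2| := by
    have hodd : (2 * a + 1 : ℤ) ≠ 0 := by omega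
    have h1 : (1 : ℤ) ≤ |2 * a + 1| := Int.one_le_abs hodd
    have h1' : (1 : ℝ) ≤ |(2 * (a : ℝ) + 1)| := by exact_mod_cast h1
    have h2 : (2 * (a : ℝ) + 1) = 2 * ((a : ℝ) + 1 / 2) := by ring
    rw [h2, abs_mul, abs_two] at h1'
    linarith
  rw [← sq_abs, klfs_abs_fermiMatsubara hβ a]
  have hpos : 0 < 2 * π / β * |(a : ℝ) + 1 / 2| := by positivity
  rw [inv_le_iff_one_le_mul₀ (by positivity)]
  calc (1 : ℝ) ≤ 2 * |(a : ℝ) + 1 / 2| := by linarith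
    _ = (β / (2 * π)) ^ 2 * 2 / |(a : ℝ) + 1 / 2| * (2 * π / β * |(a : ℝ) + 1 / 2|) ^ 2 := by
        field_simp

/-- **The Lipschitz modulus of the frame symbol**: for an admissible frame, `β > 0` and every label `a`,
`‖(e_K(x) − iω_a)⁻¹ − (e_K(y) − iω_a)⁻¹‖ ≤ ((7√2·β²/(2π²))/|a+½|)·‖x − y‖_∞`. -/
theorem klfr_frameSymbol_sub_le {β : ℝ} (hβ : 0 < β) {R : RenConsts} {U : ℝ} {N : ℕ} {μ : ℝ} {K : TrigPolyC4v}
    (hK : FrameOK R U N μ K) (a : ℤ) (x y : Fin 2 → ℝ) :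
    ‖((bandCT μ K x : ℂ) - Complex.I * (fermiMatsubara β a : ℂ))⁻¹ -
        ((bandCT μ K y : ℂ) - Complex.I * (fermiMatsubara β a : ℂ))⁻¹‖ ≤
      7 * Real.sqrt 2 * β ^ 2 / (2 * π ^ 2) / |(a : ℝ) + 1 / 2| * ‖x - y‖ := by
  have ha := klsf_abs_add_half_pos a
  have hω := klfs_fermiMatsubara_ne_zero hβ a
  have h1 := klvf_norm_inv_sub_inv_le hω (bandCT μ K x) (bandCT μ K y)
  have h2 := klfr_abs_bandCT_sub_le hK x y
  have h3 := klfr_inv_sq_fermiMatsubara_le hβ a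
  have hω2 : 0 < (fermiMatsubara β a) ^ 2 := by positivity
  calc _ ≤ |bandCT μ K x - bandCT μ K y| / (fermiMatsubara β a) ^ 2 := h1
    _ = |bandCT μ K x - bandCT μ K y| * ((fermiMatsubara β a) ^ 2)⁻¹ := by rw [div_eq_mul_inv]
    _ ≤ (7 * Real.sqrt 2 * ‖x - y‖) * ((β / (2 * π)) ^ 2 * 2 / |(a : ℝ) + 1 / 2|) :=
        mul_le_mul h2 h3 (by positivity) (by positivity)
    _ = 7 * Real.sqrt 2 * β ^ 2 / (2 * π ^ 2) / |(a : ℝ) + 1 / 2| * ‖x - y‖ := by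
        field_simp

/-- **The BARE band is `4`-Lipschitz for the sup norm**: `|ξ(x) − ξ(y)| ≤ 4‖x − y‖_∞` (`ξ = bandCT μ 0 = −2(cos x₀ + cos x₁) − μ`; no frame
hypothesis). -/
theorem klfr_abs_bandCT_zero_sub_le (μ : ℝ) (x y : Fin 2 → ℝ) : |bandCT μ 0 x - bandCT μ 0 y| ≤ 4 * ‖x - y‖ := by
  have hsub : bandCT μ 0 x - bandCT μ 0 y = -2 * ∑ i, (Real.cos (x i) - Real.cos (y i)) := by
    simp only [bandCT, TrigPolyC4v.eval_zero, Finset.sum_sub_distrib]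
    ring
  rw [hsub, abs_mul, abs_neg, abs_two]
  have hcoord : ∀ i, |Real.cos (x i) - Real.cos (y i)| ≤ ‖x - y‖ := fun i =>
    (Real.abs_cos_sub_cos_le _ _).trans (by simpa [Real.norm_eq_abs] using norm_le_pi_norm (x - y) i)
  calc 2 * |∑ i, (Real.cos (x i) - Real.cos (y i))| ≤ 2 * ∑ i, |Real.cos (x i) - Real.cos (y i)| := by
        gcongr; exact Finset.abs_sum_le_sum_abs _ _
    _ ≤ 2 * ∑ _i : Fin 2, ‖x - y‖ := by gcongr with i; exact hcoord i
    _ = 4 * ‖x - y‖ := by simp [Finset.sum_const, Finset.card_univ, Fintype.card_fin]; ring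

/-- **The Lipschitz modulus of the BARE symbol**: for `β > 0`, every `μ` and label `a`,
`‖(ξ(x) − iω_a)⁻¹ − (ξ(y) − iω_a)⁻¹‖ ≤ ((2β²/π²)/|a+½|)·‖x − y‖_∞` (no frame hypothesis). -/
theorem klfr_bareSymbol_sub_le {β : ℝ} (hβ : 0 < β) (μ : ℝ) (a : ℤ) (x y : Fin 2 → ℝ) :
    ‖((bandCT μ 0 x : ℂ) - Complex.I * (fermiMatsubara β a : ℂ))⁻¹ -
        ((bandCT μ 0 y : ℂ) - Complex.I * (fermiMatsubara β a : ℂ))⁻¹‖ ≤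
      2 * β ^ 2 / π ^ 2 / |(a : ℝ) + 1 / 2| * ‖x - y‖ := by
  have ha := klsf_abs_add_half_pos a
  have hω := klfs_fermiMatsubara_ne_zero hβ a
  have h1 := klvf_norm_inv_sub_inv_le hω (bandCT μ 0 x) (bandCT μ 0 y)
  have h2 := klfr_abs_bandCT_zero_sub_le μ x y
  have h3 := klfr_inv_sq_fermiMatsubara_le hβ a
  calc _ ≤ |bandCT μ 0 x - bandCT μ 0 y| / (fermiMatsubara β a) ^ 2 := h1
    _ = |bandCT μ 0 x - bandCT μ 0 y| * ((fermiMatsubara β a) ^ 2)⁻¹ := by rw [div_eq_mul_inv]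
    _ ≤ (4 * ‖x - y‖) * ((β / (2 * π)) ^ 2 * 2 / |(a : ℝ) + 1 / 2|) :=
        mul_le_mul h2 h3 (by positivity) (by positivity)
    _ = 2 * β ^ 2 / π ^ 2 / |(a : ℝ) + 1 / 2| * ‖x - y‖ := by
        field_simp
        ring

/-! ## §3 The sunset of the frame propagator obeys the Cauchy stub's inequality -/

/-- **ORDER-`U²` WITNESS of `stub_vl_twoVolumeRate` for every admissible frame.**  For `β > 0` and `FrameOK R U N μ K`, the finite-volume
sunset functional of the frame propagator symbol family satisfies: `∃ L₀ Mth D ρ, ρ → 0 ∧ ∀ L ≥ L₀ ∀ M ≥ Mth L ∀ L′ ≥ L ∀ M′ ≥ Mth L′ ∀ σ ω ω′`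
with the same Matsubara integer `∀ k k′`, `‖klSunset L M β g (ω,k) σ − klSunset L′ M′ β g (ω′,k′) σ‖ ≤ ρ L + D·Σ_i |p_k i − p′_{k′} i|_𝕋`
(`klSunset_twoVolumeRate_stubShape` at `C = β/2π`, `K = 7√2·β²/(2π²)`). -/
theorem klSunset_frame_twoVolumeRate {β : ℝ} (hβ : 0 < β) {R : RenConsts} {U : ℝ} {N : ℕ} {μ : ℝ} {K : TrigPolyC4v}
    (hK : FrameOK R U N μ K) :
    ∃ L₀ : ℕ, ∃ Mth : ℕ → ℕ, ∃ D : ℝ, ∃ ρ : ℕ → ℝ, Tendsto ρ atTop (𝓝 0) ∧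
      ∀ (L : ℕ) [NeZero L], L₀ ≤ L → ∀ (M : ℕ) [NeZero M], Mth L ≤ M →
        ∀ (L' : ℕ) [NeZero L'], L ≤ L' → ∀ (M' : ℕ) [NeZero M'], Mth L' ≤ M' →
          ∀ (σ : Fin 2) (ω : MatsubaraIdx M) (ω' : MatsubaraIdx M'), matsubaraInt M ω = matsubaraInt M' ω' →
            ∀ (k : TorusSite 2 L) (k' : TorusSite 2 L'),
              ‖klSunset L M β (fun a x => ((bandCT μ K x : ℂ) - Complex.I * (fermiMatsubara β a : ℂ))⁻¹) (ω, k) σ -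
                  klSunset L' M' β (fun a x => ((bandCT μ K x : ℂ) - Complex.I * (fermiMatsubara β a : ℂ))⁻¹) (ω', k') σ‖ ≤
                ρ L + D * ∑ i, torusAbs (latticeMomentum L k i - latticeMomentum L' k' i) :=
  klSunset_twoVolumeRate_stubShape hβ (g := fun a x => ((bandCT μ K x : ℂ) - Complex.I * (fermiMatsubara β a : ℂ))⁻¹)
    (C := β / (2 * π)) (K := 7 * Real.sqrt 2 * β ^ 2 / (2 * π ^ 2)) (by positivity) (by positivity)
    (fun a x m => klfs_frameSymbol_periodic β μ K a x m) (fun a x => klfs_frameSymbol_norm_le hβ μ K a x)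
    (fun a x y => klfr_frameSymbol_sub_le hβ hK a x y)

/-- **ORDER-`U²` WITNESS at the BARE frame** (the symbol `(ξ(x) − iω_a)⁻¹` of the k3c5 lane's true-carrier identification
`sunsetSum_div_eq_klSunset`): for every `β > 0` and `μ`, the sunset functional of the bare symbol satisfies the inequality of
`stub_vl_twoVolumeRate` (`klSunset_twoVolumeRate_stubShape` at `C = β/2π`, `K = 2β²/π²`; no frame hypothesis). -/
theorem klSunset_bare_twoVolumeRate {β : ℝ} (hβ : 0 < β) (μ : ℝ) :
    ∃ L₀ : ℕ, ∃ Mth : ℕ → ℕ, ∃ D : ℝ, ∃ ρ : ℕ → ℝ, Tendsto ρ atTop (𝓝 0) ∧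
      ∀ (L : ℕ) [NeZero L], L₀ ≤ L → ∀ (M : ℕ) [NeZero M], Mth L ≤ M →
        ∀ (L' : ℕ) [NeZero L'], L ≤ L' → ∀ (M' : ℕ) [NeZero M'], Mth L' ≤ M' →
          ∀ (σ : Fin 2) (ω : MatsubaraIdx M) (ω' : MatsubaraIdx M'), matsubaraInt M ω = matsubaraInt M' ω' →
            ∀ (k : TorusSite 2 L) (k' : TorusSite 2 L'),
              ‖klSunset L M β (fun a x => ((bandCT μ 0 x : ℂ) - Complex.I * (fermiMatsubara β a : ℂ))⁻¹) (ω, k) σ -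
                  klSunset L' M' β (fun a x => ((bandCT μ 0 x : ℂ) - Complex.I * (fermiMatsubara β a : ℂ))⁻¹) (ω', k') σ‖ ≤
                ρ L + D * ∑ i, torusAbs (latticeMomentum L k i - latticeMomentum L' k' i) :=
  klSunset_twoVolumeRate_stubShape hβ (g := fun a x => ((bandCT μ 0 x : ℂ) - Complex.I * (fermiMatsubara β a : ℂ))⁻¹)
    (C := β / (2 * π)) (K := 2 * β ^ 2 / π ^ 2) (by positivity) (by positivity)
    (fun a x m => klfs_frameSymbol_periodic β μ 0 a x m) (fun a x => klfs_frameSymbol_norm_le hβ μ 0 a x)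
    (fun a x y => klfr_bareSymbol_sub_le hβ μ a x y)

end Summit.HubbardSuperconductivity.HubbardSuperconductivity.Theorems.KLRegimeSplit

end
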